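import Summits.AnomalousDissipation.AnomalousDissipation.Theses.SolenoidalFractalHomogenisation
import HarnessLib

/-!
# `SolenoidalFractalHomogenisation.Assembly` holds (route `route-AnomalousDissipation-SolenoidalFractalHomogenisation`,
# item `Assembly`, stmt-AnomalousDissipation-19075)

The assembly item of the route — `ProjectedRenormalisationStep → QuasiStaticSolenoidalCellTensorQ → PermissibleFractalCarrier →
CascadeBookkeeping → Target` — is four lines of logic: K2Q supplies the lattice word `W` with its exact isotropic gain `c₀` and the
gain family, K1 turns them into thresholds `ν₀, K, Λ₀` and the renormalisation bound for every permissible regular carrier datum on `W`,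
K3 supplies such a datum, and the bookkeeping support item converts the renormalisation bound into the leaf (`Target`).
Cell ad-ideate, seat ad-p1 (route kit HOME/ad-ideate-p1/route/glue.lean, closer file
HOME/ad-ideate-p1/route/SolenoidalFractalHomogenisationAssembly.lean, referee hand-verified 08:51:31Z); filed by the cell's prover
seat with the proof term verbatim and the declaration moved to the `Theorems` namespace (the route file's `Theses` namespace is
gate-written; a `Theses….Assembly_holds` there would collide with the gate's own `_holds` link).
-/

-- `Summit.<Summit>.<Problem>` is the tree's mandated summit-side namespace (CONVENTIONS §2); for this
-- single-conjunct summit the two coincide, so the duplicate is deliberate (lakefile: off for `Summits`).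
set_option linter.dupNamespace false

namespace Summit.AnomalousDissipation.AnomalousDissipation.Theorems

open Summit.AnomalousDissipation.AnomalousDissipation.Theses.SolenoidalFractalHomogenisation

/-- Closes the route assembly item `Assembly` (stmt-AnomalousDissipation-19075): three cruxes and the bookkeeping support
give the leaf `Target` (seat ad-p1's four-line glue, verbatim). -/
theorem solenoidalFractalHomogenisation_assembly_proof :
    Summit.AnomalousDissipation.AnomalousDissipation.Theses.SolenoidalFractalHomogenisation.Assembly := by
  intro h₁ h₂ h₃ s
  obtain ⟨k, W, c₀, hc₀, hiso, hfam⟩ := h₂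
  obtain ⟨ν₀, hν₀, K, hK, Λ₀, h₁'⟩ := h₁ k W c₀ hc₀ hiso hfam
  obtain ⟨D, hD, hg, hn, hKD, hP, hR, hsep⟩ := h₃ k W c₀ ν₀ K Λ₀ hc₀ hν₀ hK
  exact s k D hP hR (h₁' D hD hg hn hKD hP hR hsep)

end Summit.AnomalousDissipation.AnomalousDissipation.Theorems
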